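import Summits.NavierStokesRegularity.NavierStokesRegularity.Theorems.TypeICertificateLadderRungReynoldsOneRateBookkeeping

/-!
# Crux `Target` = `TypeICertificateLadder.NoTypeIBlowup` (stmt-NavierStokesRegularity-1217): the
# `q = 5/2` WINDOW of the ladder — the rate bookkeeping step with generic exponents

`--supports stmt-NavierStokesRegularity-1217` (second file of the parametric version of rung one's
chain; companion of `…TargetFiveHalvesWindowAprioriDecay.lean`).

`RungReynoldsOne.enstrophyDecay_of` with the literal input exponents `15/16` (weighted `L^{5/2}`
vorticity mass) and `1/2` (enstrophy) replaced by parameters `α, β ≥ 0`: fed into the Lamb-form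
slab enstrophy inequality `∫|∇u(t)|² ≤ ∫|∇u(0)|² + (2ν)⁻¹∫₀ᵗ‖u‖²_{L^{10}}‖curl u‖²_{L^{5/2}}`
(rung one's stub S4) on the Tao-class sub-slabs (stub S5), with `∫|u|^{10} ≤ ‖u‖⁴_∞∫|u|⁶`, Sobolev
and `∫|curl u|^{5/2} ≤ ∫F(curl u)`, the rates `∫F(curl u) ≤ K₁(T−s)^{-α}`,
`∫|∇u|² ≤ K₂(T−s)^{-β}`, `|u|² ≤ M/(T−s)` give an integrand `≲ (T−s)^{-e}`,
`e = (2+3β)/5 + 4α/5`, hence for `e > 1` the growth bound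
`‖u(t)‖₂² + ‖∇u(t)‖₂² ≤ K (T−t)^{-(e−1)}` on `[T/2, T)` (`enstrophyDecay_step`). With the
rate-`C` inputs `α = 15C²/16`, `β = C²/2` of the companion file, `e − 1 = 21C²/20 − 3/5`, which is
`< 1/2` iff `C² < 22/21` (third file: the rungs `X_C`, `C < √(22/21)`); iterating the step on its own
output drives `β` to the fixed point `15C²/8 − 3/2 < 1/2 ⟺ C² < 16/15`, the full `q = 5/2` window.
[folklore: Grönwall bookkeeping]
-/

noncomputable section

open Set Filter Topology MeasureTheory
open scoped RealInnerProductSpace ENNReal NNReal Laplacian ContDiff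
open Literature.Analysis.FluidPDE

namespace Summit.NavierStokesRegularity.NavierStokesRegularity.Theorems.FiveHalvesWindow

-- the problem directory `NavierStokesRegularity/NavierStokesRegularity` forces the duplicated namespace
set_option linter.dupNamespace false

open Summit.NavierStokesRegularity.NavierStokesRegularity.Theorems.RungReynoldsOne

/-- `∫₀ᵗ (T−s)^{-e} ds ≤ (1/γ)(T−t)^{-γ}` for `0 ≤ t < T`, `γ > 0`, `e = γ + 1`, as a lower Lebesgue
integral (generic form of `RungReynoldsOne.lintegral_Ioo_rpow_sub_le`, `e = 29/20`). -/
theorem lintegral_Ioo_rpow_neg_le {T t γ e : ℝ} (hγ : 0 < γ) (he : e = γ + 1) (ht0 : 0 ≤ t)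
    (htT : t < T) :
    ∫⁻ s in Ioo 0 t, ENNReal.ofReal ((T - s) ^ (-e)) ≤
      ENNReal.ofReal (1 / γ * (T - t) ^ (-γ)) := by
  have hpos : ∀ s ∈ Icc 0 t, 0 < T - s := fun s hs => by linarith [hs.2]
  have hcont : ContinuousOn (fun s => (T - s) ^ (-e)) (Icc 0 t) :=
    (continuousOn_const.sub continuousOn_id).rpow_const fun s hs => Or.inl (hpos s hs).ne'
  have hint : IntegrableOn (fun s => (T - s) ^ (-e)) (Ioo 0 t) volume :=
    (hcont.integrableOn_compact isCompact_Icc).mono_set Ioo_subset_Icc_self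
  have hnn : 0 ≤ᵐ[volume.restrict (Ioo 0 t)] fun s => (T - s) ^ (-e) := by
    refine (ae_restrict_iff' measurableSet_Ioo).2 (Eventually.of_forall fun s hs => ?_)
    exact Real.rpow_nonneg (hpos s (Ioo_subset_Icc_self hs)).le _
  rw [← ofReal_integral_eq_lintegral_ofReal hint hnn]
  refine ENNReal.ofReal_le_ofReal ?_
  -- FTC with the antiderivative `s ↦ (1/γ) (T − s)^{-γ}`
  have hderiv : ∀ s ∈ uIcc 0 t,
      HasDerivAt (fun s => 1 / γ * (T - s) ^ (-γ)) ((T - s) ^ (-e)) s := by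
    intro s hs
    rw [uIcc_of_le ht0] at hs
    have h1 : HasDerivAt (fun s => T - s) (-1) s := by simpa using (hasDerivAt_id s).const_sub T
    have h2 := (h1.rpow_const (p := -γ) (Or.inl (hpos s hs).ne')).const_mul (1 / γ)
    refine h2.congr_deriv ?_
    rw [show (-γ) - 1 = -e by rw [he]; ring]
    field_simp
  have hFTC := intervalIntegral.integral_eq_sub_of_hasDerivAt hderiv
    ((hcont.mono (by rw [uIcc_of_le ht0])).intervalIntegrable)
  rw [← integral_Ioc_eq_integral_Ioo, ← intervalIntegral.integral_of_le ht0, hFTC]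
  have hT0 : 0 ≤ 1 / γ * (T - 0) ^ (-γ) := mul_nonneg (by positivity) (Real.rpow_nonneg (by linarith) _)
  linarith

/-- **Rate bookkeeping step (generic exponents).** GIVEN, along a classical solution on `ℝ³ × [0,T)`
which is Leray–Hopf from its rapidly decaying datum, the a-priori power rates
`∫F(curl u(t)) ≤ K₁(T−t)^{-α}`, `∫|∇u(t)|²_F ≤ K₂(T−t)^{-β}`, `‖u(t,x)‖² ≤ M/(T−t)` on `(0,T)`
, the Lamb-form slab enstrophy inequality (rung one's stub S4) and the Tao-class
cover (stub S5): if the production exponent `e := (2 + 3β)/5 + 4α/5` exceeds `1`, then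
`‖u(t)‖₂² + ‖∇u(t)‖₂² ≤ K (T−t)^{-(e − 1)}` on `[T/2, T)`. (`α = 15/16`, `β = 1/2` give rung one's
`e − 1 = 9/20`, `RungReynoldsOne.enstrophyDecay_of`; the integrand is
`‖u‖²_{L^{10}}‖ω‖²_{L^{5/2}} ≲ (T−s)^{-2/5-3β/5} (T−s)^{-4α/5}`.) -/
theorem enstrophyDecay_step
    (hL : ∀ ⦃ν T : ℝ⦄, 0 < ν → 0 < T →
      ∀ ⦃u : ℝ → EuclideanSpace ℝ (Fin 3) → EuclideanSpace ℝ (Fin 3)⦄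
        ⦃p : ℝ → EuclideanSpace ℝ (Fin 3) → ℝ⦄,
        IsClassicalNSSolutionOn (Icc 0 T) ν 0 u p →
        HasBoundedSobolevNormsOn (Icc 0 T) u →
        HasBoundedSobolevNormsOn (Icc 0 T) (timeDerivWithin (Icc 0 T) u) →
        (∀ n : ℕ, ∃ C : ℝ≥0, ∀ t ∈ Icc 0 T, ∫⁻ x, ‖iteratedFDeriv ℝ n (p t) x‖ₑ ^ 2 ≤ C) →
      ∀ ⦃s : ℝ⦄, s ∈ Ioc 0 T →
        ∫⁻ x, ENNReal.ofReal (frobeniusNormSq (fderiv ℝ (u s) x)) ≤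
          (∫⁻ x, ENNReal.ofReal (frobeniusNormSq (fderiv ℝ (u 0) x))) +
            ENNReal.ofReal ((2 * ν)⁻¹) *
              ∫⁻ t in Ioo 0 s, (∫⁻ x, ‖u t x‖ₑ ^ (10 : ℝ)) ^ (1 / 5 : ℝ) *
                (∫⁻ x, ‖curl (u t) x‖ₑ ^ (5 / 2 : ℝ)) ^ (4 / 5 : ℝ))
    (hC : ∀ ⦃ν T : ℝ⦄, 0 < ν → 0 < T →
      ∀ ⦃u : ℝ → EuclideanSpace ℝ (Fin 3) → EuclideanSpace ℝ (Fin 3)⦄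
        ⦃p : ℝ → EuclideanSpace ℝ (Fin 3) → ℝ⦄,
        IsClassicalNSSolutionOn (Ico 0 T) ν 0 u p → IsLerayHopfOn T ν 0 (u 0) u →
        HasRapidSpatialDecay (u 0) →
      ∀ ⦃T' : ℝ⦄, T' ∈ Ioo 0 T →
        ∃ q : ℝ → EuclideanSpace ℝ (Fin 3) → ℝ,
          IsClassicalNSSolutionOn (Icc 0 T') ν 0 u q ∧
          HasBoundedSobolevNormsOn (Icc 0 T') u ∧
          HasBoundedSobolevNormsOn (Icc 0 T') (timeDerivWithin (Icc 0 T') u) ∧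
          (∀ n : ℕ, ∃ C : ℝ≥0, ∀ t ∈ Icc 0 T', ∫⁻ x, ‖iteratedFDeriv ℝ n (q t) x‖ₑ ^ 2 ≤ C))
    {ν T : ℝ} (hν : 0 < ν) (hT : 0 < T)
    {u : ℝ → EuclideanSpace ℝ (Fin 3) → EuclideanSpace ℝ (Fin 3)}
    {p : ℝ → EuclideanSpace ℝ (Fin 3) → ℝ}
    (hsol : IsClassicalNSSolutionOn (Ico 0 T) ν 0 u p) (hLH : IsLerayHopfOn T ν 0 (u 0) u)
    (hdec : HasRapidSpatialDecay (u 0))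
    {α β : ℝ} (he : 1 < (2 + 3 * β) / 5 + 4 * α / 5)
    {K₁ K₂ M : ℝ}
    (hb : ∀ t ∈ Ioo 0 T,
      (∫⁻ x, ENNReal.ofReal ((‖curl (u t) x‖ ^ 2 + 1) ^ (5 / 4 : ℝ) - 1) ≤
        ENNReal.ofReal (K₁ * (T - t) ^ (-α))) ∧
      (∫⁻ x, ENNReal.ofReal (frobeniusNormSq (fderiv ℝ (u t) x)) ≤
        ENNReal.ofReal (K₂ * (T - t) ^ (-β))) ∧
      (∀ x, ‖u t x‖ ^ 2 ≤ M / (T - t))) :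
    ∃ K : ℝ, ∀ t ∈ Ico (T / 2) T,
      (∫⁻ x, ‖u t x‖ₑ ^ 2) + ∫⁻ x, ENNReal.ofReal (frobeniusNormSq (fderiv ℝ (u t) x)) ≤
        ENNReal.ofReal (K * (T - t) ^ (-((2 + 3 * β) / 5 + 4 * α / 5 - 1))) := by
  -- the exponents
  set e : ℝ := (2 + 3 * β) / 5 + 4 * α / 5 with hedef
  set γ : ℝ := e - 1 with hγdef
  have hγ0 : 0 < γ := by rw [hγdef]; linarith
  -- nonnegative versions of the constants
  set k₁ : ℝ := max K₁ 0 with hk₁; set k₂ : ℝ := max K₂ 0 with hk₂; set m : ℝ := max M 0 with hm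
  have hk₁0 : 0 ≤ k₁ := le_max_right _ _; have hk₂0 : 0 ≤ k₂ := le_max_right _ _
  have hm0 : 0 ≤ m := le_max_right _ _
  have hΦb : ∀ s ∈ Ioo 0 T, ∫⁻ x, ENNReal.ofReal ((‖curl (u s) x‖ ^ 2 + 1) ^ (5 / 4 : ℝ) - 1) ≤
      ENNReal.ofReal (k₁ * (T - s) ^ (-α)) := fun s hs =>
    (hb s hs).1.trans (ENNReal.ofReal_le_ofReal (mul_le_mul_of_nonneg_right (le_max_left _ _)
      (Real.rpow_nonneg (sub_pos.2 hs.2).le _)))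
  have hGb : ∀ s ∈ Ioo 0 T, ∫⁻ x, ENNReal.ofReal (frobeniusNormSq (fderiv ℝ (u s) x)) ≤
      ENNReal.ofReal (k₂ * (T - s) ^ (-β)) := fun s hs =>
    (hb s hs).2.1.trans (ENNReal.ofReal_le_ofReal (mul_le_mul_of_nonneg_right (le_max_left _ _)
      (Real.rpow_nonneg (sub_pos.2 hs.2).le _)))
  have hub : ∀ s ∈ Ioo 0 T, ∀ x, ‖u s x‖ ^ 2 ≤ m / (T - s) := fun s hs x =>
    ((hb s hs).2.2 x).trans (div_le_div_of_nonneg_right (le_max_left _ _) (sub_pos.2 hs.2).le)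
  -- the Sobolev constant and the combined constant of the integrand
  set KS : ℝ≥0 := SNormLESNormFDerivOfEqConst (EuclideanSpace ℝ (Fin 3))
    (volume : Measure (EuclideanSpace ℝ (Fin 3))) 2 with hKS
  set cL : ℝ := m ^ 2 * ((KS : ℝ) ^ 6 * k₂ ^ 3) with hcL
  have hcL0 : 0 ≤ cL := by positivity
  set c₀ : ℝ := cL ^ (1 / 5 : ℝ) * k₁ ^ (4 / 5 : ℝ) with hc₀
  have hc₀0 : 0 ≤ c₀ := by positivity
  -- THE INTEGRAND BOUND: `I(s) ≤ c₀ (T−s)^{-e}` on `(0, T)`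
  have hI : ∀ s ∈ Ioo 0 T, (∫⁻ x, ‖u s x‖ₑ ^ (10 : ℝ)) ^ (1 / 5 : ℝ) *
      (∫⁻ x, ‖curl (u s) x‖ₑ ^ (5 / 2 : ℝ)) ^ (4 / 5 : ℝ) ≤
      ENNReal.ofReal (c₀ * (T - s) ^ (-e)) := by
    intro s hs
    have hTs : 0 < T - s := sub_pos.2 hs.2; have hsI : s ∈ Icc 0 T := ⟨hs.1.le, hs.2.le⟩
    -- the vorticity factor
    have hJ : (∫⁻ x, ‖curl (u s) x‖ₑ ^ (5 / 2 : ℝ)) ^ (4 / 5 : ℝ) ≤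
        ENNReal.ofReal (k₁ ^ (4 / 5 : ℝ) * (T - s) ^ (-(4 * α / 5))) := by
      have h1 : ∫⁻ x, ‖curl (u s) x‖ₑ ^ (5 / 2 : ℝ) ≤ ENNReal.ofReal (k₁ * (T - s) ^ (-α)) :=
        (lintegral_mono fun x => enorm_rpow_five_halves_le_weightF (curl (u s) x)).trans (hΦb s hs)
      calc (∫⁻ x, ‖curl (u s) x‖ₑ ^ (5 / 2 : ℝ)) ^ (4 / 5 : ℝ)
          ≤ (ENNReal.ofReal (k₁ * (T - s) ^ (-α))) ^ (4 / 5 : ℝ) := by gcongr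
        _ = ENNReal.ofReal (k₁ ^ (4 / 5 : ℝ) * (T - s) ^ (-(4 * α / 5))) := by
            rw [ENNReal.ofReal_rpow_of_nonneg (mul_nonneg hk₁0 (Real.rpow_nonneg hTs.le _))
              (by norm_num), Real.mul_rpow hk₁0 (Real.rpow_nonneg hTs.le _),
              ← Real.rpow_mul hTs.le]
            rw [show (-α) * (4 / 5 : ℝ) = -(4 * α / 5) by ring]
    -- the velocity factor: `∫‖u‖ₑ^{10} ≤ (m/(T−s))² K_S⁶ (k₂ (T−s)^{-β})³ = cL (T−s)^{-(2+3β)}`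
    have h6 : ∫⁻ x, ‖u s x‖ₑ ^ (6 : ℝ) ≤ (KS : ℝ≥0∞) ^ (6 : ℝ) *
        (ENNReal.ofReal (k₂ * (T - s) ^ (-β))) ^ (3 : ℝ) :=
      (lintegral_enorm_six_le_frobenius ((hsol.contDiff_velocity ⟨hs.1.le, hs.2⟩).of_le
        (by norm_cast)) (hLH.memLp s hsI).eLpNorm_lt_top).trans (by gcongr; exact hGb s hs)
    have hLs : ∫⁻ x, ‖u s x‖ₑ ^ (10 : ℝ) ≤ ENNReal.ofReal (cL * (T - s) ^ (-(2 + 3 * β))) := by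
      calc ∫⁻ x, ‖u s x‖ₑ ^ (10 : ℝ)
          ≤ ENNReal.ofReal (m / (T - s)) ^ 2 * ∫⁻ x, ‖u s x‖ₑ ^ (6 : ℝ) :=
            lintegral_enorm_ten_le (hub s hs)
        _ ≤ ENNReal.ofReal (m / (T - s)) ^ 2 * ((KS : ℝ≥0∞) ^ (6 : ℝ) *
            (ENNReal.ofReal (k₂ * (T - s) ^ (-β))) ^ (3 : ℝ)) := by gcongr
        _ = ENNReal.ofReal (cL * (T - s) ^ (-(2 + 3 * β))) := by
            have hk2r : 0 ≤ k₂ * (T - s) ^ (-β) := mul_nonneg hk₂0 (Real.rpow_nonneg hTs.le _)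
            rw [← ENNReal.ofReal_coe_nnreal, ENNReal.ofReal_rpow_of_nonneg (NNReal.coe_nonneg _)
              (by norm_num), ENNReal.ofReal_rpow_of_nonneg hk2r (by norm_num),
              ← ENNReal.ofReal_pow (div_nonneg hm0 hTs.le), ← ENNReal.ofReal_mul (by positivity),
              ← ENNReal.ofReal_mul (by positivity)]
            congr 1
            rw [hcL, Real.mul_rpow hk₂0 (Real.rpow_nonneg hTs.le _), ← Real.rpow_mul hTs.le,
              div_pow, show (KS : ℝ) ^ (6 : ℝ) = (KS : ℝ) ^ (6 : ℕ) by
                rw [← Real.rpow_natCast]; norm_num,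
              show k₂ ^ (3 : ℝ) = k₂ ^ (3 : ℕ) by rw [← Real.rpow_natCast]; norm_num]
            have hpow2 : (T - s) ^ 2 = (T - s) ^ (2 : ℝ) := by
              rw [← Real.rpow_natCast]; norm_num
            rw [hpow2, div_eq_mul_inv, ← Real.rpow_neg hTs.le]
            have hexp : (T - s) ^ (-(2 : ℝ)) * (T - s) ^ (-β * 3) = (T - s) ^ (-(2 + 3 * β)) := by
              rw [← Real.rpow_add hTs]; congr 1; ring
            rw [← hexp]
            ring
    have hL5 : (∫⁻ x, ‖u s x‖ₑ ^ (10 : ℝ)) ^ (1 / 5 : ℝ) ≤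
        ENNReal.ofReal (cL ^ (1 / 5 : ℝ) * (T - s) ^ (-((2 + 3 * β) / 5))) := by
      calc (∫⁻ x, ‖u s x‖ₑ ^ (10 : ℝ)) ^ (1 / 5 : ℝ)
          ≤ (ENNReal.ofReal (cL * (T - s) ^ (-(2 + 3 * β)))) ^ (1 / 5 : ℝ) := by gcongr
        _ = ENNReal.ofReal (cL ^ (1 / 5 : ℝ) * (T - s) ^ (-((2 + 3 * β) / 5))) := by
            rw [ENNReal.ofReal_rpow_of_nonneg (mul_nonneg hcL0 (Real.rpow_nonneg hTs.le _))
              (by norm_num), Real.mul_rpow hcL0 (Real.rpow_nonneg hTs.le _),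
              ← Real.rpow_mul hTs.le]
            rw [show (-(2 + 3 * β)) * (1 / 5 : ℝ) = -((2 + 3 * β) / 5) by ring]
    -- combine
    calc (∫⁻ x, ‖u s x‖ₑ ^ (10 : ℝ)) ^ (1 / 5 : ℝ) * (∫⁻ x, ‖curl (u s) x‖ₑ ^ (5 / 2 : ℝ)) ^ (4 / 5 : ℝ)
        ≤ ENNReal.ofReal (cL ^ (1 / 5 : ℝ) * (T - s) ^ (-((2 + 3 * β) / 5))) *
            ENNReal.ofReal (k₁ ^ (4 / 5 : ℝ) * (T - s) ^ (-(4 * α / 5))) := mul_le_mul' hL5 hJ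
      _ = ENNReal.ofReal (c₀ * (T - s) ^ (-e)) := by
          rw [← ENNReal.ofReal_mul (mul_nonneg (Real.rpow_nonneg hcL0 _) (Real.rpow_nonneg hTs.le _))]
          congr 1
          have hexp : (T - s) ^ (-((2 + 3 * β) / 5)) * (T - s) ^ (-(4 * α / 5)) = (T - s) ^ (-e) := by
            rw [← Real.rpow_add hTs]; congr 1; rw [hedef]; ring
          rw [hc₀, ← hexp]
          ring
  -- finiteness of the initial enstrophy (Tao cover at `T/2`) and the energy bound
  have hT2 : T / 2 ∈ Ioo 0 T := ⟨by linarith, by linarith⟩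
  obtain ⟨q₀, -, hu₀, -, -⟩ := hC hν hT hsol hLH hdec hT2
  obtain ⟨C₁, hC₁⟩ := hu₀ 1
  have hG0 : ∫⁻ x, ENNReal.ofReal (frobeniusNormSq (fderiv ℝ (u 0) x)) ≤ 3 * C₁ := by
    calc ∫⁻ x, ENNReal.ofReal (frobeniusNormSq (fderiv ℝ (u 0) x))
        ≤ ∫⁻ x, 3 * ‖iteratedFDeriv ℝ 1 (u 0) x‖ₑ ^ 2 := lintegral_mono fun x => by
          rw [← ofReal_norm, norm_iteratedFDeriv_one, ofReal_norm]
          exact ofReal_frobeniusNormSq_le_three_mul_enorm_sq _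
      _ = 3 * ∫⁻ x, ‖iteratedFDeriv ℝ 1 (u 0) x‖ₑ ^ 2 := lintegral_const_mul' _ _ (by norm_num)
      _ ≤ 3 * C₁ := by gcongr; exact hC₁ 0 ⟨le_rfl, hT2.1.le⟩
  have hG0top : ∫⁻ x, ENNReal.ofReal (frobeniusNormSq (fderiv ℝ (u 0) x)) ≠ ⊤ :=
    (hG0.trans_lt (ENNReal.mul_lt_top (by norm_num) ENNReal.coe_lt_top)).ne
  set G0 : ℝ := (∫⁻ x, ENNReal.ofReal (frobeniusNormSq (fderiv ℝ (u 0) x))).toReal with hG0def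
  set E0 : ℝ := max (2 * VectorCalculus.kineticEnergy (u 0)) 0 with hE0def
  have hE0 : 0 ≤ E0 := le_max_right _ _; have hG0nn : 0 ≤ G0 := ENNReal.toReal_nonneg
  have hEt : ∀ t ∈ Icc 0 T, ∫⁻ x, ‖u t x‖ₑ ^ 2 ≤ ENNReal.ofReal E0 := fun t ht =>
    (hLH.lintegral_enorm_sq_le hν.le ht).trans (ENNReal.ofReal_le_ofReal (le_max_left _ _))
  -- the constant
  set K : ℝ := (E0 + G0) * T ^ γ + (2 * ν)⁻¹ * (c₀ * (1 / γ)) with hK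
  refine ⟨K, fun t ht => ?_⟩
  have ht0 : 0 < t := lt_of_lt_of_le hT2.1 ht.1
  have htI : t ∈ Ioo 0 T := ⟨ht0, ht.2⟩; have hTt : 0 < T - t := sub_pos.2 ht.2
  obtain ⟨q, hsolt, hut, hutt, hqt⟩ := hC hν hT hsol hLH hdec htI
  have hmain := hL hν ht0 hsolt hut hutt hqt ⟨ht0, le_rfl⟩
  -- the time integral of the production bound
  have hint : ∫⁻ s in Ioo 0 t, (∫⁻ x, ‖u s x‖ₑ ^ (10 : ℝ)) ^ (1 / 5 : ℝ) *
      (∫⁻ x, ‖curl (u s) x‖ₑ ^ (5 / 2 : ℝ)) ^ (4 / 5 : ℝ) ≤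
      ENNReal.ofReal (c₀ * (1 / γ * (T - t) ^ (-γ))) := by
    calc ∫⁻ s in Ioo 0 t, (∫⁻ x, ‖u s x‖ₑ ^ (10 : ℝ)) ^ (1 / 5 : ℝ) *
          (∫⁻ x, ‖curl (u s) x‖ₑ ^ (5 / 2 : ℝ)) ^ (4 / 5 : ℝ)
        ≤ ∫⁻ s in Ioo 0 t, ENNReal.ofReal c₀ * ENNReal.ofReal ((T - s) ^ (-e)) := by
          refine setLIntegral_mono' measurableSet_Ioo fun s hs => ?_
          rw [← ENNReal.ofReal_mul hc₀0]
          exact hI s ⟨hs.1, hs.2.trans ht.2⟩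
      _ = ENNReal.ofReal c₀ * ∫⁻ s in Ioo 0 t, ENNReal.ofReal ((T - s) ^ (-e)) :=
          lintegral_const_mul' _ _ ENNReal.ofReal_ne_top
      _ ≤ ENNReal.ofReal c₀ * ENNReal.ofReal (1 / γ * (T - t) ^ (-γ)) := by
          gcongr; rw [hγdef]; exact lintegral_Ioo_rpow_neg_le hγ0 (by simp) ht0.le ht.2
      _ = ENNReal.ofReal (c₀ * (1 / γ * (T - t) ^ (-γ))) := (ENNReal.ofReal_mul hc₀0).symm
  -- assemble
  have hpos9 : 0 ≤ (T - t) ^ (-γ) := Real.rpow_nonneg hTt.le _; have hν2 : 0 ≤ (2 * ν)⁻¹ := by positivity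
  have hγinv : 0 ≤ 1 / γ := by positivity
  have hGt : ∫⁻ x, ENNReal.ofReal (frobeniusNormSq (fderiv ℝ (u t) x)) ≤
      ENNReal.ofReal (G0 + (2 * ν)⁻¹ * (c₀ * (1 / γ * (T - t) ^ (-γ)))) := by
    refine hmain.trans ?_
    rw [ENNReal.ofReal_add hG0nn (by positivity), ENNReal.ofReal_mul hν2, ENNReal.ofReal_toReal hG0top]
    gcongr
  -- `E0 + G0 ≤ (E0 + G0) T^{γ} (T − t)^{-γ}`
  have hone : 1 ≤ T ^ γ * (T - t) ^ (-γ) := by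
    have h1 : T ^ (-γ) ≤ (T - t) ^ (-γ) := by
      rw [Real.rpow_neg hTt.le, Real.rpow_neg hT.le]
      exact inv_anti₀ (Real.rpow_pos_of_pos hTt _)
        (Real.rpow_le_rpow hTt.le (by linarith [ht0]) hγ0.le)
    have h2 : T ^ γ * T ^ (-γ) = 1 := by
      rw [Real.rpow_neg hT.le, mul_inv_cancel₀ (Real.rpow_pos_of_pos hT _).ne']
    calc (1 : ℝ) = T ^ γ * T ^ (-γ) := h2.symm
      _ ≤ T ^ γ * (T - t) ^ (-γ) :=
          mul_le_mul_of_nonneg_left h1 (Real.rpow_nonneg hT.le _)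
  calc (∫⁻ x, ‖u t x‖ₑ ^ 2) + ∫⁻ x, ENNReal.ofReal (frobeniusNormSq (fderiv ℝ (u t) x))
      ≤ ENNReal.ofReal E0 +
          ENNReal.ofReal (G0 + (2 * ν)⁻¹ * (c₀ * (1 / γ * (T - t) ^ (-γ)))) :=
        add_le_add (hEt t ⟨ht0.le, ht.2.le⟩) hGt
    _ = ENNReal.ofReal (E0 + (G0 + (2 * ν)⁻¹ * (c₀ * (1 / γ * (T - t) ^ (-γ))))) :=
        (ENNReal.ofReal_add hE0 (by positivity)).symm
    _ ≤ ENNReal.ofReal (K * (T - t) ^ (-γ)) := by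
        refine ENNReal.ofReal_le_ofReal ?_
        have hEG : 0 ≤ E0 + G0 := add_nonneg hE0 hG0nn
        have h3 : E0 + G0 ≤ (E0 + G0) * (T ^ γ * (T - t) ^ (-γ)) :=
          le_mul_of_one_le_right hEG hone
        rw [hK]
        nlinarith [h3, hpos9, hc₀0, hν2, hγinv, mul_nonneg hc₀0 hγinv, mul_nonneg (mul_nonneg hν2 (mul_nonneg hc₀0 hγinv)) hpos9]

end Summit.NavierStokesRegularity.NavierStokesRegularity.Theorems.FiveHalvesWindow

end
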